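import Mathlib
import Summits.NavierStokesRegularity.NavierStokesRegularity.Theorems.SubcriticalEnvelopeViscousTailEnvelopeOrthant
import HarnessLib

/-!
# `SubcriticalEnvelope.ForwardSourceTailEnvelope` (stmt-NavierStokesRegularity-26373, crux A⁺) —
the ORTHANT HALF with the full mode set, and the orthant/sign-mixing glue (helper file,
`--supports`)

Route SubcriticalEnvelope rev 5–7 replaced the total-energy envelope A‴ = `ViscousTailEnvelope`
(stmt-26128, now an aside) by the FORWARD-SOURCE envelope A⁺ = `ForwardSourceTailEnvelope`: the same
`ν`-uniform window-wise subcritical bound, but only for the partial tail energies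
`Σ_{k=n..N} Σ_{i∈S} ½X_{i,k}(t)²` of SOME mode set `S` containing every forward source of the table
(`i ∉ S ⇒ α i j l (0,0,1) = 0`).  This file records the bookkeeping that carries the orthant-half
work over to A⁺:

* `forwardSourceTailEnvelope_of_viscousTailEnvelope`: A‴ ⇒ A⁺ (take `S = univ`; the planner's
  Sketch2 check, landed);
* `forwardSourceTailEnvelope_orthantHalf_of_viscousOrthantHalf`: the orthant half of A‴ on a
  sub-class `P` of tables (shape of `viscousTailEnvelope_orthantHalf_of_ceilingOn`) gives the
  orthant half of A⁺ on `P` (A⁺'s body with the Kamke orthant condition and `P α` inserted after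
  `InTableClass R α`), again with `S = univ`;
* `forwardSourceTailEnvelope_orthantHalf_of_ceilingOn` / `…_of_orthantTailCeiling`: hence the
  orthant half of A⁺ on any class of orthant tables carrying the sub-Onsager tail ceiling
  `CeilingAt` of route SubOnsagerCeiling (class-restricted form, anticipating a re-typing of
  stmt-25507 to exit-complete tables), resp. on all orthant tables under `OrthantTailCeiling`;
* `forwardSourceTailEnvelope_of_orthantHalf_of_mixingHalf`: orthant half ∧ sign-mixing half ⇒ A⁺
  (threshold `min εs₁ εs₂`, case split on the orthant predicate);
* `forwardSourceTailEnvelope_of_orthantTailCeiling_of_mixingHalf`: `OrthantTailCeiling` ∧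
  sign-mixing half ⇒ A⁺.

HONEST FRAMING: statements about Tao-type MODEL lattice ODEs (rung TL-M2Break); the ceiling
hypotheses are OPEN statements of the sibling route (stmt-25507 is predicted refuted-misstated on
dead-end tables by CENSUS-24639-v3 — the implications here stay valid, the class-restricted form
stays useful); nothing here bears on the Navier–Stokes equations, and no summit is proved.
-/

noncomputable section

-- the sub-problem namespace `NavierStokesRegularity.NavierStokesRegularity` is the tree's layout (D-0017)
set_option linter.dupNamespace false

namespace Summit.NavierStokesRegularity.NavierStokesRegularity.Theorems

open Set
open Literature.Analysis.FluidPDE.TaoCascade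
open Summit.NavierStokesRegularity.NavierStokesRegularity.Theses

/-- **A‴ ⇒ A⁺.** The total-energy envelope `ViscousTailEnvelope` implies the forward-source
envelope `ForwardSourceTailEnvelope`: take the mode set `S = univ` (trivially source-complete); the
partial tail energy over `univ` is the total tail energy.  Pure logic; MODEL lattice statement.
[this file] -/
theorem forwardSourceTailEnvelope_of_viscousTailEnvelope
    (h : SubcriticalEnvelope.ViscousTailEnvelope) :
    SubcriticalEnvelope.ForwardSourceTailEnvelope := by
  intro R hR
  obtain ⟨εs, hεs, H⟩ := h R hR
  refine ⟨εs, hεs, fun ε₀ hε₀ hle α hα => ⟨Finset.univ, fun i hi => absurd (Finset.mem_univ i) hi,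
    fun X₀ => ?_⟩⟩
  obtain ⟨η, hη, Hη⟩ := H ε₀ hε₀ hle α hα X₀
  exact ⟨η, hη, Hη⟩

/-- **Orthant half: A‴-shape ⇒ A⁺-shape (on a sub-class `P`).** If the clause of
`ViscousTailEnvelope` holds for the orthant tables of every `E₂(R)` lying in a class `P`, below a
threshold `εs(R)` (the shape produced by `viscousTailEnvelope_orthantHalf_of_ceilingOn`; `P = ⊤` is
the shape of `viscousTailEnvelope_orthantHalf_of_orthantTailCeiling`), then the clause of
`ForwardSourceTailEnvelope` holds for them with the full mode set `S = univ`.  Pure logic; MODEL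
lattice statement. [this file] -/
theorem forwardSourceTailEnvelope_orthantHalf_of_viscousOrthantHalf
    (P : (Fin 4 → Fin 4 → Fin 4 → ℤ × ℤ × ℤ → ℝ) → Prop)
    (hO : ∀ R : ℝ, 1 ≤ R → ∃ εs : ℝ, 0 < εs ∧ ∀ ε₀ : ℝ, 0 < ε₀ → ε₀ ≤ εs →
      ∀ α : Fin 4 → Fin 4 → Fin 4 → ℤ × ℤ × ℤ → ℝ, InTableClass R α →
      (∀ (Y : Fin 4 → ℤ → ℝ → ℝ) (τ : ℝ), (∀ (j : Fin 4) (k : ℤ), 1 ≤ k → 0 ≤ Y j k τ) →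
        ∀ δ : ℝ, 0 < δ → ∀ (i : Fin 4) (n : ℤ), 1 ≤ n → Y i n τ = 0 → 0 ≤ quadTerm δ α Y i n τ) →
      P α →
      ∀ X₀ : Fin 4 → ℝ, ∃ η : ℝ, 0 < η ∧ ∀ T : ℝ, 0 < T → ∃ C : ℝ, ∀ ν : ℝ, 0 < ν →
      ∀ s ∈ Ioc (0 : ℝ) T, ∀ X : Fin 4 → ℤ → ℝ → ℝ,
      (∀ i k, X i k 0 = if k = 0 then X₀ i else 0) →
      (∀ i k, k < 0 → ∀ t, X i k t = 0) →
      (∃ M : ℝ, ∀ (t : ℝ) (i : Fin 4) (k : ℤ), (1 + (1 + ε₀) ^ ((10 : ℝ) * k)) * |X i k t| ≤ M) →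
      (∀ i k, Continuous (X i k)) →
      (∀ i k, ∀ t ∈ Icc (0 : ℝ) s, HasDerivWithinAt (X i k)
        (quadTerm ε₀ α X i k t - ν * (1 + ε₀) ^ ((2 : ℝ) * k) * X i k t) (Icc 0 s) t) →
      ∀ n N : ℕ, n ≤ N → ∀ t ∈ Icc (0 : ℝ) s,
        ∑ k ∈ Finset.Icc n N, ∑ i, (1 / 2) * X i (k : ℤ) t ^ 2 ≤
          C * (1 + ε₀) ^ (-((1 + η) * (n : ℝ)))) :
    ∀ R : ℝ, 1 ≤ R → ∃ εs : ℝ, 0 < εs ∧ ∀ ε₀ : ℝ, 0 < ε₀ → ε₀ ≤ εs →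
      ∀ α : Fin 4 → Fin 4 → Fin 4 → ℤ × ℤ × ℤ → ℝ, InTableClass R α →
      (∀ (Y : Fin 4 → ℤ → ℝ → ℝ) (τ : ℝ), (∀ (j : Fin 4) (k : ℤ), 1 ≤ k → 0 ≤ Y j k τ) →
        ∀ δ : ℝ, 0 < δ → ∀ (i : Fin 4) (n : ℤ), 1 ≤ n → Y i n τ = 0 → 0 ≤ quadTerm δ α Y i n τ) →
      P α →
      ∃ S : Finset (Fin 4), (∀ i, i ∉ S → ∀ j l : Fin 4, α i j l (0, 0, 1) = 0) ∧
      ∀ X₀ : Fin 4 → ℝ, ∃ η : ℝ, 0 < η ∧ ∀ T : ℝ, 0 < T → ∃ C : ℝ, ∀ ν : ℝ, 0 < ν →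
      ∀ s ∈ Ioc (0 : ℝ) T, ∀ X : Fin 4 → ℤ → ℝ → ℝ,
      (∀ i k, X i k 0 = if k = 0 then X₀ i else 0) →
      (∀ i k, k < 0 → ∀ t, X i k t = 0) →
      (∃ M : ℝ, ∀ (t : ℝ) (i : Fin 4) (k : ℤ), (1 + (1 + ε₀) ^ ((10 : ℝ) * k)) * |X i k t| ≤ M) →
      (∀ i k, Continuous (X i k)) →
      (∀ i k, ∀ t ∈ Icc (0 : ℝ) s, HasDerivWithinAt (X i k)
        (quadTerm ε₀ α X i k t - ν * (1 + ε₀) ^ ((2 : ℝ) * k) * X i k t) (Icc 0 s) t) →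
      ∀ n N : ℕ, n ≤ N → ∀ t ∈ Icc (0 : ℝ) s,
        ∑ k ∈ Finset.Icc n N, ∑ i ∈ S, (1 / 2) * X i (k : ℤ) t ^ 2 ≤
          C * (1 + ε₀) ^ (-((1 + η) * (n : ℝ))) := by
  intro R hR
  obtain ⟨εs, hεs, H⟩ := hO R hR
  refine ⟨εs, hεs, fun ε₀ hε₀ hle α hα hK hP =>
    ⟨Finset.univ, fun i hi => absurd (Finset.mem_univ i) hi, fun X₀ => ?_⟩⟩
  obtain ⟨η, hη, Hη⟩ := H ε₀ hε₀ hle α hα hK hP X₀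
  exact ⟨η, hη, Hη⟩

/-- **Orthant half of A⁺ on a sub-class.** If the sub-Onsager tail ceiling `CeilingAt R ε₀ α` of
route SubOnsagerCeiling is known for the tables of a class `P` at every spread `R ≥ 1` and every
scale ratio `ε₀ ∈ (0,1]`, then the clause of `ForwardSourceTailEnvelope` holds for the ORTHANT tables
of `E₂(R)` in `P`, with threshold `εs = 1`, full mode set `S = univ` and margin `η = 2θ − 1` (cone
invariance + ceiling, `viscousTailEnvelope_orthantHalf_of_ceilingOn`).  MODEL lattice statement;
the ceiling is an open hypothesis. [this file] -/
theorem forwardSourceTailEnvelope_orthantHalf_of_ceilingOn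
    (P : (Fin 4 → Fin 4 → Fin 4 → ℤ × ℤ × ℤ → ℝ) → Prop)
    (hceil : ∀ R : ℝ, 1 ≤ R → ∀ ε₀ : ℝ, 0 < ε₀ → ε₀ ≤ 1 →
      ∀ α : Fin 4 → Fin 4 → Fin 4 → ℤ × ℤ × ℤ → ℝ, P α → SubOnsagerCeiling.CeilingAt R ε₀ α) :
    ∀ R : ℝ, 1 ≤ R → ∃ εs : ℝ, 0 < εs ∧ ∀ ε₀ : ℝ, 0 < ε₀ → ε₀ ≤ εs →
      ∀ α : Fin 4 → Fin 4 → Fin 4 → ℤ × ℤ × ℤ → ℝ, InTableClass R α →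
      (∀ (Y : Fin 4 → ℤ → ℝ → ℝ) (τ : ℝ), (∀ (j : Fin 4) (k : ℤ), 1 ≤ k → 0 ≤ Y j k τ) →
        ∀ δ : ℝ, 0 < δ → ∀ (i : Fin 4) (n : ℤ), 1 ≤ n → Y i n τ = 0 → 0 ≤ quadTerm δ α Y i n τ) →
      P α →
      ∃ S : Finset (Fin 4), (∀ i, i ∉ S → ∀ j l : Fin 4, α i j l (0, 0, 1) = 0) ∧
      ∀ X₀ : Fin 4 → ℝ, ∃ η : ℝ, 0 < η ∧ ∀ T : ℝ, 0 < T → ∃ C : ℝ, ∀ ν : ℝ, 0 < ν →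
      ∀ s ∈ Ioc (0 : ℝ) T, ∀ X : Fin 4 → ℤ → ℝ → ℝ,
      (∀ i k, X i k 0 = if k = 0 then X₀ i else 0) →
      (∀ i k, k < 0 → ∀ t, X i k t = 0) →
      (∃ M : ℝ, ∀ (t : ℝ) (i : Fin 4) (k : ℤ), (1 + (1 + ε₀) ^ ((10 : ℝ) * k)) * |X i k t| ≤ M) →
      (∀ i k, Continuous (X i k)) →
      (∀ i k, ∀ t ∈ Icc (0 : ℝ) s, HasDerivWithinAt (X i k)
        (quadTerm ε₀ α X i k t - ν * (1 + ε₀) ^ ((2 : ℝ) * k) * X i k t) (Icc 0 s) t) →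
      ∀ n N : ℕ, n ≤ N → ∀ t ∈ Icc (0 : ℝ) s,
        ∑ k ∈ Finset.Icc n N, ∑ i ∈ S, (1 / 2) * X i (k : ℤ) t ^ 2 ≤
          C * (1 + ε₀) ^ (-((1 + η) * (n : ℝ))) :=
  forwardSourceTailEnvelope_orthantHalf_of_viscousOrthantHalf P
    (viscousTailEnvelope_orthantHalf_of_ceilingOn P hceil)

/-- **Orthant half of A⁺ from `OrthantTailCeiling`.** Under the sibling crux
`SubOnsagerCeiling.OrthantTailCeiling` (stmt-25507) the clause of `ForwardSourceTailEnvelope` holds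
for every orthant table of `E₂(R)`, `R ≥ 1`, with `εs = 1` and `S = univ`.  MODEL lattice
statement; `OrthantTailCeiling` is an open hypothesis. [this file] -/
theorem forwardSourceTailEnvelope_orthantHalf_of_orthantTailCeiling
    (hceil : SubOnsagerCeiling.OrthantTailCeiling) :
    ∀ R : ℝ, 1 ≤ R → ∃ εs : ℝ, 0 < εs ∧ ∀ ε₀ : ℝ, 0 < ε₀ → ε₀ ≤ εs →
      ∀ α : Fin 4 → Fin 4 → Fin 4 → ℤ × ℤ × ℤ → ℝ, InTableClass R α →
      (∀ (Y : Fin 4 → ℤ → ℝ → ℝ) (τ : ℝ), (∀ (j : Fin 4) (k : ℤ), 1 ≤ k → 0 ≤ Y j k τ) →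
        ∀ δ : ℝ, 0 < δ → ∀ (i : Fin 4) (n : ℤ), 1 ≤ n → Y i n τ = 0 → 0 ≤ quadTerm δ α Y i n τ) →
      ∃ S : Finset (Fin 4), (∀ i, i ∉ S → ∀ j l : Fin 4, α i j l (0, 0, 1) = 0) ∧
      ∀ X₀ : Fin 4 → ℝ, ∃ η : ℝ, 0 < η ∧ ∀ T : ℝ, 0 < T → ∃ C : ℝ, ∀ ν : ℝ, 0 < ν →
      ∀ s ∈ Ioc (0 : ℝ) T, ∀ X : Fin 4 → ℤ → ℝ → ℝ,
      (∀ i k, X i k 0 = if k = 0 then X₀ i else 0) →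
      (∀ i k, k < 0 → ∀ t, X i k t = 0) →
      (∃ M : ℝ, ∀ (t : ℝ) (i : Fin 4) (k : ℤ), (1 + (1 + ε₀) ^ ((10 : ℝ) * k)) * |X i k t| ≤ M) →
      (∀ i k, Continuous (X i k)) →
      (∀ i k, ∀ t ∈ Icc (0 : ℝ) s, HasDerivWithinAt (X i k)
        (quadTerm ε₀ α X i k t - ν * (1 + ε₀) ^ ((2 : ℝ) * k) * X i k t) (Icc 0 s) t) →
      ∀ n N : ℕ, n ≤ N → ∀ t ∈ Icc (0 : ℝ) s,
        ∑ k ∈ Finset.Icc n N, ∑ i ∈ S, (1 / 2) * X i (k : ℤ) t ^ 2 ≤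
          C * (1 + ε₀) ^ (-((1 + η) * (n : ℝ))) := by
  intro R hR
  obtain ⟨εs, hεs, H⟩ := forwardSourceTailEnvelope_orthantHalf_of_ceilingOn (fun _ => True)
    (fun R hR ε₀ hε₀ hle α _ => (SubOnsagerCeiling.orthantTailCeiling_iff_ceilingAt.1 hceil)
      R hR ε₀ hε₀ hle α) R hR
  exact ⟨εs, hεs, fun ε₀ hε₀ hle α hα hK => H ε₀ hε₀ hle α hα hK trivial⟩

/-- **Glue of the orthant/sign-mixing split of A⁺.** If the clause of `ForwardSourceTailEnvelope`
holds (threshold `εs₁(R)`) for the orthant tables of every `E₂(R)` and (threshold `εs₂(R)`) for the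
sign-mixing ones, then `ForwardSourceTailEnvelope` holds with `εs = min εs₁ εs₂` (case split on the
Kamke orthant predicate, as in `SubOnsagerCeiling.closes`).  Pure logic; MODEL lattice statement.
[this file] -/
theorem forwardSourceTailEnvelope_of_orthantHalf_of_mixingHalf
    (hO : ∀ R : ℝ, 1 ≤ R → ∃ εs : ℝ, 0 < εs ∧ ∀ ε₀ : ℝ, 0 < ε₀ → ε₀ ≤ εs →
      ∀ α : Fin 4 → Fin 4 → Fin 4 → ℤ × ℤ × ℤ → ℝ, InTableClass R α →
      (∀ (Y : Fin 4 → ℤ → ℝ → ℝ) (τ : ℝ), (∀ (j : Fin 4) (k : ℤ), 1 ≤ k → 0 ≤ Y j k τ) →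
        ∀ δ : ℝ, 0 < δ → ∀ (i : Fin 4) (n : ℤ), 1 ≤ n → Y i n τ = 0 → 0 ≤ quadTerm δ α Y i n τ) →
      ∃ S : Finset (Fin 4), (∀ i, i ∉ S → ∀ j l : Fin 4, α i j l (0, 0, 1) = 0) ∧
      ∀ X₀ : Fin 4 → ℝ, ∃ η : ℝ, 0 < η ∧ ∀ T : ℝ, 0 < T → ∃ C : ℝ, ∀ ν : ℝ, 0 < ν →
      ∀ s ∈ Ioc (0 : ℝ) T, ∀ X : Fin 4 → ℤ → ℝ → ℝ,
      (∀ i k, X i k 0 = if k = 0 then X₀ i else 0) →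
      (∀ i k, k < 0 → ∀ t, X i k t = 0) →
      (∃ M : ℝ, ∀ (t : ℝ) (i : Fin 4) (k : ℤ), (1 + (1 + ε₀) ^ ((10 : ℝ) * k)) * |X i k t| ≤ M) →
      (∀ i k, Continuous (X i k)) →
      (∀ i k, ∀ t ∈ Icc (0 : ℝ) s, HasDerivWithinAt (X i k)
        (quadTerm ε₀ α X i k t - ν * (1 + ε₀) ^ ((2 : ℝ) * k) * X i k t) (Icc 0 s) t) →
      ∀ n N : ℕ, n ≤ N → ∀ t ∈ Icc (0 : ℝ) s,
        ∑ k ∈ Finset.Icc n N, ∑ i ∈ S, (1 / 2) * X i (k : ℤ) t ^ 2 ≤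
          C * (1 + ε₀) ^ (-((1 + η) * (n : ℝ))))
    (hM : ∀ R : ℝ, 1 ≤ R → ∃ εs : ℝ, 0 < εs ∧ ∀ ε₀ : ℝ, 0 < ε₀ → ε₀ ≤ εs →
      ∀ α : Fin 4 → Fin 4 → Fin 4 → ℤ × ℤ × ℤ → ℝ, InTableClass R α →
      ¬ (∀ (Y : Fin 4 → ℤ → ℝ → ℝ) (τ : ℝ), (∀ (j : Fin 4) (k : ℤ), 1 ≤ k → 0 ≤ Y j k τ) →
        ∀ δ : ℝ, 0 < δ → ∀ (i : Fin 4) (n : ℤ), 1 ≤ n → Y i n τ = 0 → 0 ≤ quadTerm δ α Y i n τ) →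
      ∃ S : Finset (Fin 4), (∀ i, i ∉ S → ∀ j l : Fin 4, α i j l (0, 0, 1) = 0) ∧
      ∀ X₀ : Fin 4 → ℝ, ∃ η : ℝ, 0 < η ∧ ∀ T : ℝ, 0 < T → ∃ C : ℝ, ∀ ν : ℝ, 0 < ν →
      ∀ s ∈ Ioc (0 : ℝ) T, ∀ X : Fin 4 → ℤ → ℝ → ℝ,
      (∀ i k, X i k 0 = if k = 0 then X₀ i else 0) →
      (∀ i k, k < 0 → ∀ t, X i k t = 0) →
      (∃ M : ℝ, ∀ (t : ℝ) (i : Fin 4) (k : ℤ), (1 + (1 + ε₀) ^ ((10 : ℝ) * k)) * |X i k t| ≤ M) →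
      (∀ i k, Continuous (X i k)) →
      (∀ i k, ∀ t ∈ Icc (0 : ℝ) s, HasDerivWithinAt (X i k)
        (quadTerm ε₀ α X i k t - ν * (1 + ε₀) ^ ((2 : ℝ) * k) * X i k t) (Icc 0 s) t) →
      ∀ n N : ℕ, n ≤ N → ∀ t ∈ Icc (0 : ℝ) s,
        ∑ k ∈ Finset.Icc n N, ∑ i ∈ S, (1 / 2) * X i (k : ℤ) t ^ 2 ≤
          C * (1 + ε₀) ^ (-((1 + η) * (n : ℝ)))) :
    SubcriticalEnvelope.ForwardSourceTailEnvelope := by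
  intro R hR
  obtain ⟨ε₁, hε₁, H₁⟩ := hO R hR
  obtain ⟨ε₂, hε₂, H₂⟩ := hM R hR
  refine ⟨min ε₁ ε₂, lt_min hε₁ hε₂, fun ε₀ hε₀ hle α hα => ?_⟩
  by_cases hK : (∀ (Y : Fin 4 → ℤ → ℝ → ℝ) (τ : ℝ), (∀ (j : Fin 4) (k : ℤ), 1 ≤ k → 0 ≤ Y j k τ) →
      ∀ δ : ℝ, 0 < δ → ∀ (i : Fin 4) (n : ℤ), 1 ≤ n → Y i n τ = 0 → 0 ≤ quadTerm δ α Y i n τ)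
  · exact H₁ ε₀ hε₀ (hle.trans (min_le_left _ _)) α hα hK
  · exact H₂ ε₀ hε₀ (hle.trans (min_le_right _ _)) α hα hK

/-- **A⁺ from `OrthantTailCeiling` and the sign-mixing half.** The sibling crux
`SubOnsagerCeiling.OrthantTailCeiling` (stmt-25507) and the sign-mixing half of the forward-source
envelope give `ForwardSourceTailEnvelope` — modulo 25507, A⁺ reduces to its sign-mixing conjunct
(= the residual `NonOrthantBreak` in envelope form).  MODEL lattice statement; both hypotheses are
open. [this file] -/
theorem forwardSourceTailEnvelope_of_orthantTailCeiling_of_mixingHalf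
    (hceil : SubOnsagerCeiling.OrthantTailCeiling)
    (hM : ∀ R : ℝ, 1 ≤ R → ∃ εs : ℝ, 0 < εs ∧ ∀ ε₀ : ℝ, 0 < ε₀ → ε₀ ≤ εs →
      ∀ α : Fin 4 → Fin 4 → Fin 4 → ℤ × ℤ × ℤ → ℝ, InTableClass R α →
      ¬ (∀ (Y : Fin 4 → ℤ → ℝ → ℝ) (τ : ℝ), (∀ (j : Fin 4) (k : ℤ), 1 ≤ k → 0 ≤ Y j k τ) →
        ∀ δ : ℝ, 0 < δ → ∀ (i : Fin 4) (n : ℤ), 1 ≤ n → Y i n τ = 0 → 0 ≤ quadTerm δ α Y i n τ) →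
      ∃ S : Finset (Fin 4), (∀ i, i ∉ S → ∀ j l : Fin 4, α i j l (0, 0, 1) = 0) ∧
      ∀ X₀ : Fin 4 → ℝ, ∃ η : ℝ, 0 < η ∧ ∀ T : ℝ, 0 < T → ∃ C : ℝ, ∀ ν : ℝ, 0 < ν →
      ∀ s ∈ Ioc (0 : ℝ) T, ∀ X : Fin 4 → ℤ → ℝ → ℝ,
      (∀ i k, X i k 0 = if k = 0 then X₀ i else 0) →
      (∀ i k, k < 0 → ∀ t, X i k t = 0) →
      (∃ M : ℝ, ∀ (t : ℝ) (i : Fin 4) (k : ℤ), (1 + (1 + ε₀) ^ ((10 : ℝ) * k)) * |X i k t| ≤ M) →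
      (∀ i k, Continuous (X i k)) →
      (∀ i k, ∀ t ∈ Icc (0 : ℝ) s, HasDerivWithinAt (X i k)
        (quadTerm ε₀ α X i k t - ν * (1 + ε₀) ^ ((2 : ℝ) * k) * X i k t) (Icc 0 s) t) →
      ∀ n N : ℕ, n ≤ N → ∀ t ∈ Icc (0 : ℝ) s,
        ∑ k ∈ Finset.Icc n N, ∑ i ∈ S, (1 / 2) * X i (k : ℤ) t ^ 2 ≤
          C * (1 + ε₀) ^ (-((1 + η) * (n : ℝ)))) :
    SubcriticalEnvelope.ForwardSourceTailEnvelope :=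
  forwardSourceTailEnvelope_of_orthantHalf_of_mixingHalf
    (forwardSourceTailEnvelope_orthantHalf_of_orthantTailCeiling hceil) hM

end Summit.NavierStokesRegularity.NavierStokesRegularity.Theorems

end
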